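import Mathlib
import HarnessLib
import HarnessLib.Audit
import Summits.QuantumFields.Statement
import Summits.QuantumFields.YangMills.Theorems.SelfNormalisedSkewness.Negative.SelfNormalisedSkewnessFalseOfMaxwellDominatedWindowScheme
import Literature.MathematicalPhysics.QuantumLattice.GaugeGroupsProofs
import HarnessLib.Audit.Status.Attr

/-!
Route: BoundedSkewnessRunning

# Route BoundedSkewnessRunning — Gapped SU(2) schemes cannot generate tr F² skewness, so YangMills
fails at IsNonGaussian

REFUTATION route (concludes `¬ YangMills`; realises the mwave sketch bounded-skewness-running,
readers PASS). X = K1 ∧ K2 over the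
self-normalised third cumulant κ₃ᶜᵃⁿ_k(u; f,g,h) = `cruxKappa3 r sch u f g h k` of the smeared
curvature species `tr F²` (the functional
of the refuted floor SelfNormalisedSkewness of route ScalingWindowSplit, used here with the OPPOSITE
sign). K1 (UVSkewnessExtinction): for
some κ ≥ 1, along every SU(2) weak-coupling scheme inside the polynomial UV window a_k⁻¹ ≤ β_k^κ,
κ₃ᶜᵃⁿ_k → 0 on every compactly
supported pairwise-disjoint real triple. K2 (SkewnessNonGeneration, deciding): for every κ ≥ 1, a
weak-coupling SU(2) scheme with a
volume-uniform lattice mass gap and a test function meeting the RP-doubling window T_k(u) ≤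
M·T_k(τ₋₁u) inherits that extinction from its
UV companion (same β_k, L_k; spacing max(a_k, β_k^(−κ))). With three supports (c³-scaling of the
cumulant, window-from-nontriviality,
off-diagonal reduction of IsNonGaussian) X forces the continuum third cumulant of tr F² of any
YangMills witness at G = SU(2) to vanish.
Lean: `UVSkewnessExtinction ∧ SkewnessNonGeneration`

## Assembly
Pure logic plus tree theorems (the deciding theorem `closes`, ≈ 100 lines, elaborates with 0
sorries): at G = SU(2)
(`isCompactSimpleLieGroup_specialUnitaryGroup isSimpleCompactGroup_specialUnitaryGroup_holds
le_rfl`; the Statement's `letI borel`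
instances are the tree's SU(2) instances by `rfl`) a YangMills witness gives r, sch, T with
HasWeakCouplingLimit, IsYangMillsFor,
IsNontrivial, IsNonGaussian, Δ > 0 and HasLatticeMassGap; K1 gives κ; WindowFromNontriviality gives
(u, M, σ); the UV companion
sch' := ⟨sch.β, k ↦ max (sch.a k) ((sch.β k)^κ)⁻¹, sch.L, sch.c⟩ is a weak-coupling scheme (a' → 0
since β → ∞, κ ≥ 1) inside the
κ-window, so K1 applies to it; K2 transfers extinction to sch; SchemeCumulantScaling and the seven
IsYangMillsFor limits
(c³√T³·κ₃ᶜᵃⁿ → σ^{3/2}·0) make the continuum seven-term cumulant of T vanish on every compactly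
supported disjoint real triple;
OffDiagonalReduction contradicts IsNonGaussian. The Assembly item records the same implication.

Rationale: WHY THIS LINE. The hub statement asks, for EVERY compact simple G, for a weak-coupling lattice
scheme whose continuum OS limit T has a mass gap, a
lattice gap AND `T.IsNonGaussian r.curvature` (a nonzero connected three-point function of tr F² on
off-diagonal tensors); this line
grants the gap and attacks the non-Gaussianity clause at G = SU(2), typing the Patrascioiu–Seiler
"case against asymptotic freedom"
(Seiler2003 = arXiv:hep-th/0312015 pp.3–4, 10; PatrascioiuSeiler1995; Cosmai–Preparata
doi:10.1103/physrevlett.57.2613) as a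
triviality statement for the curvature channel: Gaussian domination at weak coupling kills the
self-normalised skewness in the UV window
(K1, the regime where lattice perturbation theory is the method, MontvayMunster1994; abelian model
case Driver1987, in tree as the U(1)
super-weak witness `cruxKappa3_witness_tendsto`), and the bet K2 is that a mass gap plus the
reflection-positivity window cannot
re-generate skewness between the UV companion and the correlation length — the φ⁴₄ pattern
(arXiv:1912.07973) transplanted to the
composite field tr F², with the dictionary spin field ↦ smeared action density, bubble-diagram
Gaussian bound ↦ c³√T³ self-normalisation
(SchemeCumulantScaling). Imported areas: constructive QFT / lattice statistical mechanics
(multiscale expansions, OS reconstruction);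
no continuum gauge theory. No prior route concludes ¬YangMills through IsNonGaussian: the 29
positive Theses want skewness FLOORS
(negatives index: stmt-QuantumFields-18944 SelfNormalisedSkewness refuted by a Maxwell-dominated
window scheme — the very mechanism this
line runs forward), and the one other refutation draft (WeakCouplingMasslessPhase) denies the
lattice gap instead of conceding it.

RANKED CRUXES. #2 SkewnessNonGeneration (crux) — K2 of the card (deciding; the bet). For every κ ≥
1, every SU(2) lattice representation r, weak-coupling schemes sch, sch' and compactly supported u
supported in {x₀ < 0}: if sch has a volume-uniform lattice mass gap Δ > 0, u meets the RP-doubling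
window `cruxT r sch u k ≤ M * cruxT r sch (timeShiftTest 4 (-1) u) k` eventually, and sch' is a UV
companion of sch (sch'.β = sch.β, sch'.L = sch.L, sch.a ≤ sch'.a, (sch'.a k)⁻¹ ≤ (sch'.β k)^κ
eventually) along which κ₃ᶜᵃⁿ → 0 for every admissible (u'; f,g,h), then κ₃ᶜᵃⁿ(sch, u; f,g,h) → 0
for every compactly supported pairwise-disjoint real triple (f,g,h). [deps: UVSkewnessExtinction]
[difficulty: open-problem] (why it might fail: AF+confinement inhabits every hypothesis and predicts
an O(1) connected three-point function of tr F² at scale ξ (triple-glueball coupling G²/4π ≈ 40 from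
the three-plaquette vertex, MontvayMunster1994 p.161); a gap alone breaks the self-dual cancellation
that makes the free odd ring vanish.) [Seiler2003, PatrascioiuSeiler1995, MontvayMunster1994,
arXiv:1912.07973, book:friz2019-probability-analysis-interacting-physical-systems]
#3 UVSkewnessExtinction (crux) — K1 of the card (UV extinction). There is κ ≥ 1 such that for every
SU(2) lattice representation r, every weak-coupling scheme sch with (sch.a k)⁻¹ ≤ (sch.β k)^κ
eventually, every compactly supported u supported in {x₀ < 0} and every compactly supported
pairwise-disjoint real triple (f,g,h), the self-normalised third cumulant `cruxKappa3 r sch u f g h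
k` of the smeared curvature tends to 0. [difficulty: XL] (why it might fail: Needs k-uniform
two-loop control of gauge-invariant composite (tr F²) cumulants of SU(2)₄ over ≍ κ·log β_k momentum
scales with slowly growing physical volume; Bałaban's programme stops at UV stability of effective
actions (no observables), and toron / finite-size odd-ring terms must be shown o(1).)
[MontvayMunster1994, Driver1987, arXiv:1803.01950,
book:friz2019-probability-analysis-interacting-physical-systems]
#9 SchemeCumulantScaling (support) — S1 (algebra of the self-normalisation). For every compact G,
representation r, scheme sch, test functions u,f,g,h and k with 0 < cruxT r sch u k, the seven-term
third cumulant of the smeared curvature along sch equals (sch.c r.curvature k · √(cruxT r sch u k))³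
· cruxKappa3 r sch u f g h k — multilinearity of latticeSchwinger in the renormalisation constant
and the definition of cruxKappa3 (canonical normalisation c = 1/√T). [difficulty: provable-now]
[OsterwalderSeiler1978, MontvayMunster1994]
#9 WindowFromNontriviality (support) — S2 (window from non-triviality). If T is the continuum limit
of (r, sch) (`IsYangMillsFor r sch T`) and `T.IsNontrivial r.curvature`, then some compactly
supported real u supported in {x₀ < 0} has a positive continuum two-point limit σ = lim (sch.c F
k)²·cruxT r sch u k > 0 and meets the RP-doubling window cruxT r sch u k ≤ M·cruxT r sch
(timeShiftTest 4 (-1) u) k eventually — density of compactly supported real tensors in ⁰𝒮,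
reflection positivity / OS semigroup injectivity (σ(τ₋₁u) > 0), and convergence of lattice moments.
[difficulty: M] [OsterwalderSeiler1978, JaffeWitten2000, AizenmanDuminilCopin2021]
#9 OffDiagonalReduction (support) — S3 (off-diagonal reduction of IsNonGaussian). For any OS data T
and species s: if the seven-term connected three-point combination of T.schwinger vanishes on all
off-diagonal tensors of (ofRealTest f, ofRealTest g, ofRealTest h) for every compactly supported
pairwise-disjoint real Schwartz triple, then ¬ T.IsNonGaussian s — complex-to-real multilinear
splitting, compactly supported approximation inside the off-diagonal class, and continuity of the
tempered Schwinger functions. [difficulty: M] [OsterwalderSeiler1978, JaffeWitten2000]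

TWO-LAYER PLAN. K1 ⇐ (bare bound |κ₃ᵇᵃʳᵉ| ≤ ε_k·a_k¹²β_k⁻³ in the window) → (two-point Maxwell lower
bound c·a_k⁸β_k⁻² ≤ T_k(u), or T ≡ 0) → K1, glue =
the identity κ₃ᶜᵃⁿ = (√T)⁻³·κ₃ᵇᵃʳᵉ (skeleton bc/UVSkewnessExtinction_birth.lean, composition
proved). K2 ⇐ (two-point Maxwell lower
bound under gap + window) → (bare non-generation bound |κ₃ᵇᵃʳᵉ(sch)| ≤ ε_k·a_k¹²β_k⁻³ given
extinction on sch') → K2, same glue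
(bc/SkewnessNonGeneration_birth.lean, composition proved). Filed as splits only after a grounder
stamps the bare rates.

KILL CRITERIA. refuted:SkewnessNonGeneration closes the route outright (a gapped windowed SU(2)
scheme with extinct UV companion and κ₃ᶜᵃⁿ ↛ 0 —
e.g. any rigorous lower bound on the three-plaquette vertex at scale ξ, or a proof of YangMills at
SU(2)); refuted:UVSkewnessExtinction
(skewness surviving inside every polynomial UV window, e.g. a toron/finite-size odd-ring term that
is not o(1)) forces a pivot to an
exponential window a_k⁻¹ ≤ exp(κβ_k) short of ξ or closes the route if the obstruction is
scale-free. A proof of YangMills for any G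
moots nothing formally (S is ∀ G) but a proof at SU(2) refutes K2 via `closes`.
WindowFromNontriviality refuted ⇒ re-type the window
(larger shift / Schwartz u) — misstated, not substantive.

NOT DECOMPOSED YET. The bare power-counting rates (a⁸β⁻², a¹²β⁻³ with o(1) slack), the choice of κ,
the block/multiscale expansion that would control
composite cumulants, finite-volume (toron) corrections, and the OS-density lemmas inside the
supports are deliberately left to layer 2:
they are children of K1/K2 once a grounder confirms the normalisations (skeleton stubs exist in
bc/*_birth.lean).

CHEAPEST FALSIFIER. Tree-level lattice perturbation theory for the connected ⟨tr F²(f) tr F²(g) tr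
F²(h)⟩ of SU(2) Wilson theory at disjoint smeared
supports: if the O(g⁶) one-loop "triangle" term does not cancel at separated points after
self-normalisation by T^{3/2} ∝ g³-free
Maxwell two-point data (i.e. κ₃ᶜᵃⁿ ~ const·g_k⁰), K1 is dead at once; the U(1) computation (in tree:
cruxKappa3_witness_tendsto, κ₃ ≡ 0
by Gaussianity) passes, the SU(2) triangle is a one-afternoon `kit` symbolic job not yet run. For K2
the cheapest adverse evidence is
already in print: strong-coupling series estimate of the triple-glueball coupling G²/4π ≈ 40
(MontvayMunster1994 p.161, non-rigorous).

NUMBERS. κ ≥ 1 (window exponent; κ = 1 is the U(1) witness regime a_k = (k+1)⁻¹, β_k = (k+1)⁹⁶);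
bare two-point scale a⁸β⁻² and three-point
scale a¹²β⁻³ (Wilson action, F ~ a²·plaquette field, propagator ~ 1/β); SU(2) one-loop b₀ =
11/(24π²) sets ξ_k ≈ exp(β_k/(4b₀))
(MontvayMunster1994 §3); triple-glueball coupling estimate G²/4π ≈ 40 (MontvayMunster1994 eq.
(3.450)).

DEFINITION REQUESTS. None: cruxT, cruxKappa3, cruxBare, cruxCanon, E4 are imported from the landed
Negative theorem file of SelfNormalisedSkewness;
timeShiftTest, latticeSchwinger, SpeciesScheme, OSData.* exist in Literature.

Novelty: Searches (2026-08-17): lit search --hybrid "self-normalised skewness tr F^2 lattice gauge" (0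
relevant; montvay1994 pp.160–161, creutz2022 p.58 generic); lit vsearch "three-point function of the
action density vanishes at tree level / skewness of smeared plaquette" -k 10 (textbook pages only);
lit search "case against asymptotic freedom" (1: paper:arxiv-hep-th_0312015, read pp.3–4,7,10);
crossref "Patrascioiu Seiler superinstantons" (doi:10.1103/physrevlett.74.1924), "evidence against
asymptotic freedom SU(2)" (doi:10.1103/physrevlett.57.2613, doi:10.1103/physrevd.64.065006); lit
galaxy search "superinstanton" --star pdf (0 hits); lit galaxy search "superinstanton|case against
asymptotic freedom|Patrascioiu" --star all (queued > 90 s, null); galaxy pdf hit 884049072080511560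
(Shin hep-lat/9611006, cites P–S); galaxy panama 491919784280120 (Montvay–Münster); lean search
cruxKappa3|SelfNormalisedSkewness (tree: ScalingWindowSplit W₂ + its Negative file); ledger
negatives --problem QuantumFields (7; stmt-18944 nearest).
Nearest prior art found: Seiler2003 (arXiv:hep-th/0312015, the ¬AF programme, prose, 2D-centred,
p.10 "still open"); PatrascioiuSeiler1995; in tree route ScalingWindowSplit (same functional,
skewness FLOOR, refuted stmt-QuantumFields-18944 by a Maxwell-dominated window scheme) and draft
route WeakCouplingMasslessPhase (¬YangMills via deconfinement ⇒ no lattice gap).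
Delta: the ¬AF/triviality bet is typed as a checkable lattice statement on ONE dimensionless obser  [refs: 10.1103/physrevlett.74.1924, 10.1103/physrevlett.57.2613, 10.1103/physrevd.64.065006, hep-th/0312015, paper:arxiv-hep-th_0312015, doi:10.1103/physrevlett.74.1924, doi:10.1103/physrevlett.57.2613, doi:10.1103/physrevd.64.065006, Seiler2003, PatrascioiuSeiler1995]

Barriers (technique_class: weak-coupling-expansion, lattice-scaling-limit): - technique_class: weak-coupling-expansion, lattice-scaling-limit, gaussian-domination
- Literature.Barriers.QuantumFields.PerturbativeInvisibility: K1 sits outside (a UV statement,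
nothing expanded in g, no gap claimed); K2 is not quantified over by it (the gap is a hypothesis,
not derived) — but it does not evade the AF+gap consensus; the bet is that perturbative AF is not
realised by a gapped non-Gaussian continuum limit (Seiler2003 p.10).
- Literature.Barriers.QuantumFields.UVStabilityNonUniqueness: K1 and K2 sit inside its scope caveat
— closing them needs k-uniform control of gauge-invariant composite cumulants, which Bałaban-type UV
stability does not give; evasion for K1 only partial (distances ≤ β^κ ≪ ξ keep every scale
perturbative); for K2 it does not; the bet is Gaussian domination pinned by gap + RP window.
- Literature.Barriers.QuantumFields.ScalarPhi4Triviality: used as a resource, not evaded — the line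
transplants the φ⁴₄ Gaussian fate to the composite tr F²; the random-current proof does not transfer
to gauge fields (arXiv:1912.07973 §1), so the mechanism must be multiscale Gaussian domination
instead.
- Literature.Barriers.QuantumFields.ColemanGrossScalar: outside its quantifiers (perturbative
β-function sign for renormalisable Lagrangians); the route makes no claim about a Lagrangian
continuum theory, only about lattice cumulants.
- Literature.Barriers.QuantumFields.OehmeZimmermannSuperconvergence: outside (gauge-fixed transverse
gluon propagator); only gau

History (route lifecycle, newest last):
- 2026-08-27T13:03:07Z · DORMANT — reconciler: no traction for 9.7 d (last activity item-evidence-added at 2026-08-17T19:05:39Z); parked, not closed — `ledger route dormant route-QuantumFields-Bo (operator:999:3448638)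
- 2026-08-27T16:49:56Z · REACTIVATED — reconciler: reactivated — activity item-evidence-added at 2026-08-27T15:22:16Z after parking at 2026-08-27T13:03:07Z (operator:999:3927857)

sub-problem: YangMills · status: open · opened planner-type-12b83f0fa1-0 2026-08-17T18:59:58Z · rev 0 · ledger route-QuantumFields-BoundedSkewnessRunning
GENERATED by the gate from the ledger (D-0016/17). Provers cite these decls: `theorem foo : Summit.QuantumFields.YangMills.Theses.BoundedSkewnessRunning.<Decl> := …` in Summits/QuantumFields/YangMills/Theorems/<Name>.lean.
-/

namespace Summit.QuantumFields.YangMills.Theses.BoundedSkewnessRunning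

open scoped BigOperators Topology Manifold Classical MeasureTheory ProbabilityTheory Matrix InnerProductSpace ComplexConjugate ContinuousMap
open Filter Set Function TopologicalSpace MeasureTheory

attribute [summit_statement] _root_.YangMills

/-- item stmt-QuantumFields-19896 · crux · rank 2 · open · by planner
why it might fail: AF+confinement inhabits every hypothesis and predicts an O(1) connected three-point function of tr F² at scale ξ (triple-glueball coupling G²/4π ≈ 40 from the three-plaquette vertex, MontvayMunster1994 p.161); a gap alone breaks the self-dual cancellation that makes the free odd ring vanish.
sources: Seiler2003, PatrascioiuSeiler1995, MontvayMunster1994, arXiv:1912.07973, book:friz2019-probability-analysis-interacting-physical-systems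
[crux] K2 of the card (deciding; the bet). For every κ ≥ 1, every SU(2) lattice representation r,
weak-coupling schemes sch, sch' and compactly supported u supported in {x₀ < 0}: if sch has a
volume-uniform lattice mass gap Δ > 0, u meets the RP-doubling window `cruxT r sch u k ≤ M * cruxT r
sch (timeShiftTest 4 (-1) u) k` eventually, and sch' is a UV companion of sch (sch'.β = sch.β,
sch'.L = sch.L, sch.a ≤ sch'.a, (sch'.a k)⁻¹ ≤ (sch'.β k)^κ eventually) along which κ₃ᶜᵃⁿ → 0 for
every admissible (u'; f,g,h), then κ₃ᶜᵃⁿ(sch, u; f,g,h) → 0 for every compactly supported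
pairwise-disjoint real triple (f,g,h). [deps: UVSkewnessExtinction] [difficulty: open-problem] -/
@[route_item "route-QuantumFields-BoundedSkewnessRunning", crux]
def SkewnessNonGeneration : Prop :=
  open Literature.MathematicalPhysics.QuantumLattice Literature.MathematicalPhysics.AQFT Literature.MathematicalPhysics.QuantumFieldTheory Summit.QuantumFields.YangMills.Theorems.SelfNormalisedSkewness.Negative in ∀ κ : ℕ, 1 ≤ κ → ∀ (r : LatticeRep (Matrix.specialUnitaryGroup (Fin 2) ℂ)) (sch sch' : SpeciesScheme (YMSpecies (Matrix.specialUnitaryGroup (Fin 2) ℂ))) (u : SchwartzMap E4 ℝ) (M Δ : ℝ), sch.HasWeakCouplingLimit → 0 < Δ → HasLatticeMassGap r sch Δ → HasCompactSupport (u : E4 → ℝ) → tsupport u ⊆ {y : E4 | y 0 < 0} → (∀ᶠ k in Filter.atTop, cruxT r sch u k ≤ M * cruxT r sch (timeShiftTest 4 (-1) u) k) → sch'.β = sch.β → sch'.L = sch.L → (∀ k, sch.a k ≤ sch'.a k) → (∀ᶠ k in Filter.atTop, (sch'.a k)⁻¹ ≤ (sch'.β k) ^ κ) → (∀ (u' f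 g h : SchwartzMap E4 ℝ), HasCompactSupport (u' : E4 → ℝ) → tsupport u' ⊆ {y : E4 | y 0 < 0} → HasCompactSupport (f : E4 → ℝ) → HasCompactSupport (g : E4 → ℝ) → HasCompactSupport (h : E4 → ℝ) → Disjoint (tsupport f) (tsupport g) → Disjoint (tsupport f) (tsupport h) → Disjoint (tsupport g) (tsupport h) → Filter.Tendsto (cruxKappa3 r sch' u' f g h) Filter.atTop (nhds 0)) → ∀ (f g h : SchwartzMap E4 ℝ), HasCompactSupport (f : E4 → ℝ) → HasCompactSupport (g : E4 → ℝ) → HasCompactSupport (h : E4 → ℝ) → Disjoint (tsupport f) (tsupport g) → Disjoint (tsupport f) (tsupport h) → Disjoint (tsupport g) (tsupport h) → Filter.Tendsto (cruxKappa3 r sch u f g h) Filter.atTop (nhds 0)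

/-- item stmt-QuantumFields-19897 · crux · rank 3 · open · by planner
why it might fail: Needs k-uniform two-loop control of gauge-invariant composite (tr F²) cumulants of SU(2)₄ over ≍ κ·log β_k momentum scales with slowly growing physical volume; Bałaban's programme stops at UV stability of effective actions (no observables), and toron / finite-size odd-ring terms must be shown o(1).
sources: MontvayMunster1994, Driver1987, arXiv:1803.01950, book:friz2019-probability-analysis-interacting-physical-systems
[crux] K1 of the card (UV extinction). There is κ ≥ 1 such that for every SU(2) lattice
representation r, every weak-coupling scheme sch with (sch.a k)⁻¹ ≤ (sch.β k)^κ eventually, every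
compactly supported u supported in {x₀ < 0} and every compactly supported pairwise-disjoint real
triple (f,g,h), the self-normalised third cumulant `cruxKappa3 r sch u f g h k` of the smeared
curvature tends to 0. [difficulty: XL] -/
@[route_item "route-QuantumFields-BoundedSkewnessRunning", crux]
def UVSkewnessExtinction : Prop :=
  open Literature.MathematicalPhysics.QuantumLattice Literature.MathematicalPhysics.AQFT Literature.MathematicalPhysics.QuantumFieldTheory Summit.QuantumFields.YangMills.Theorems.SelfNormalisedSkewness.Negative in ∃ κ : ℕ, 1 ≤ κ ∧ ∀ (r : LatticeRep (Matrix.specialUnitaryGroup (Fin 2) ℂ)) (sch : SpeciesScheme (YMSpecies (Matrix.specialUnitaryGroup (Fin 2) ℂ))) (u : SchwartzMap E4 ℝ), sch.HasWeakCouplingLimit → (∀ᶠ k in Filter.atTop, (sch.a k)⁻¹ ≤ (sch.β k) ^ κ) → HasCompactSupport (u : E4 → ℝ) → tsupport u ⊆ {y : E4 | y 0 < 0} → ∀ (f g h : SchwartzMap E4 ℝ), HasCompactSupport (f : E4 → ℝ) → HasCompactSupport (g : E4 → ℝ) → HasCompactSupport (h : E4 → ℝ) → Disjoint (tsupport f)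 (tsupport g) → Disjoint (tsupport f) (tsupport h) → Disjoint (tsupport g) (tsupport h) → Filter.Tendsto (cruxKappa3 r sch u f g h) Filter.atTop (nhds 0)

/-- item stmt-QuantumFields-19898 · support · rank 9 · closed · proved by Summit.QuantumFields.YangMills.Theorems.SchemeCumulantScalingProof.schemeCumulantScaling_proof (prover) · by planner
sources: OsterwalderSeiler1978, MontvayMunster1994
[support] S1 (algebra of the self-normalisation). For every compact G, representation r, scheme sch,
test functions u,f,g,h and k with 0 < cruxT r sch u k, the seven-term third cumulant of the smeared
curvature along sch equals (sch.c r.curvature k · √(cruxT r sch u k))³ · cruxKappa3 r sch u f g h k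
— multilinearity of latticeSchwinger in the renormalisation constant and the definition of
cruxKappa3 (canonical normalisation c = 1/√T). [difficulty: provable-now] -/
@[route_item "route-QuantumFields-BoundedSkewnessRunning", crux]
def SchemeCumulantScaling : Prop :=
  open Literature.MathematicalPhysics.QuantumLattice Literature.MathematicalPhysics.AQFT Literature.MathematicalPhysics.QuantumFieldTheory Summit.QuantumFields.YangMills.Theorems.SelfNormalisedSkewness.Negative in ∀ (G : Type) [Group G] [TopologicalSpace G] [IsTopologicalGroup G] [CompactSpace G] [MeasurableSpace G] [BorelSpace G] (r : LatticeRep G) (sch : SpeciesScheme (YMSpecies G)) (u f g h : SchwartzMap E4 ℝ) (k : ℕ), 0 < cruxT r sch u k → latticeSchwinger r.ρ sch (fun s => s.F) k 3 (fun _ => r.curvature) ![f, g, h] - latticeSchwinger r.ρ sch (fun s => s.F) k 1 (fun _ => r.curvature) ![f] * latticeSchwinger r.ρ sch (fun s => s.F) k 2 (fun _ => r.curvature) ![g, h] - latticeSchwinger r.ρ sch (fun s => s.F) k 1 (fun _ => r.curvature) ![g] * latticeSchwinger r.ρ sch (fun s => s.F) k 2 (fun _ => r.curvature) ![f, h] -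 latticeSchwinger r.ρ sch (fun s => s.F) k 1 (fun _ => r.curvature) ![h] * latticeSchwinger r.ρ sch (fun s => s.F) k 2 (fun _ => r.curvature) ![f, g] + 2 * (latticeSchwinger r.ρ sch (fun s => s.F) k 1 (fun _ => r.curvature) ![f] * latticeSchwinger r.ρ sch (fun s => s.F) k 1 (fun _ => r.curvature) ![g] * latticeSchwinger r.ρ sch (fun s => s.F) k 1 (fun _ => r.curvature) ![h]) = (sch.c r.curvature k * Real.sqrt (cruxT r sch u k)) ^ 3 * cruxKappa3 r sch u f g h k

-- `SchemeCumulantScaling` holds: proved by `Summit.QuantumFields.YangMills.Theorems.SchemeCumulantScalingProof.schemeCumulantScaling_proof` (its module imports this route file, so no `_holds` link can be stated here).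

/-- item stmt-QuantumFields-19899 · support · rank 9 · closed · proved by Summit.QuantumFields.YangMills.Theorems.WindowFromNontriviality.boundedSkewnessRunning_windowFromNontriviality_proof (prover) · by planner
sources: OsterwalderSeiler1978, JaffeWitten2000, AizenmanDuminilCopin2021
[support] S2 (window from non-triviality). If T is the continuum limit of (r, sch) (`IsYangMillsFor
r sch T`) and `T.IsNontrivial r.curvature`, then some compactly supported real u supported in {x₀ <
0} has a positive continuum two-point limit σ = lim (sch.c F k)²·cruxT r sch u k > 0 and meets the
RP-doubling window cruxT r sch u k ≤ M·cruxT r sch (timeShiftTest 4 (-1) u) k eventually — density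
of compactly supported real tensors in ⁰𝒮, reflection positivity / OS semigroup injectivity (σ(τ₋₁u)
> 0), and convergence of lattice moments. [difficulty: M] -/
@[route_item "route-QuantumFields-BoundedSkewnessRunning", crux]
def WindowFromNontriviality : Prop :=
  open Literature.MathematicalPhysics.QuantumLattice Literature.MathematicalPhysics.AQFT Literature.MathematicalPhysics.QuantumFieldTheory Summit.QuantumFields.YangMills.Theorems.SelfNormalisedSkewness.Negative in ∀ (G : Type) [Group G] [TopologicalSpace G] [IsTopologicalGroup G] [CompactSpace G] [MeasurableSpace G] [BorelSpace G] (r : LatticeRep G) (sch : SpeciesScheme (YMSpecies G)) (T : OSData (YMSpecies G) 4), IsYangMillsFor r sch T → T.IsNontrivial r.curvature → ∃ (u : SchwartzMap E4 ℝ) (M σ : ℝ), HasCompactSupport (u : E4 → ℝ) ∧ tsupport u ⊆ {y : E4 | y 0 < 0} ∧ 0 < σ ∧ Filter.Tendsto (fun k => (sch.c r.curvature k) ^ 2 * cruxT r sch u k) Filter.atTop (nhds σ) ∧ ∀ᶠ k in Filter.atTop, cruxT r sch u k ≤ M * cruxT r sch (timeShiftTest 4 (-1) u) k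

-- `WindowFromNontriviality` holds: proved by `Summit.QuantumFields.YangMills.Theorems.WindowFromNontriviality.boundedSkewnessRunning_windowFromNontriviality_proof` (its module imports this route file, so no `_holds` link can be stated here).

/-- item stmt-QuantumFields-19900 · support · rank 9 · closed · proved by Summit.QuantumFields.YangMills.Theorems.OffDiagonalReduction.boundedSkewnessRunning_offDiagonalReduction_proof (prover) · by planner
sources: OsterwalderSeiler1978, JaffeWitten2000
[support] S3 (off-diagonal reduction of IsNonGaussian). For any OS data T and species s: if the
seven-term connected three-point combination of T.schwinger vanishes on all off-diagonal tensors of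
(ofRealTest f, ofRealTest g, ofRealTest h) for every compactly supported pairwise-disjoint real
Schwartz triple, then ¬ T.IsNonGaussian s — complex-to-real multilinear splitting, compactly
supported approximation inside the off-diagonal class, and continuity of the tempered Schwinger
functions. [difficulty: M] -/
@[route_item "route-QuantumFields-BoundedSkewnessRunning", crux]
def OffDiagonalReduction : Prop :=
  open Literature.MathematicalPhysics.QuantumLattice Literature.MathematicalPhysics.AQFT Literature.MathematicalPhysics.QuantumFieldTheory Summit.QuantumFields.YangMills.Theorems.SelfNormalisedSkewness.Negative in ∀ (ι : Type) (T : OSData ι 4) (s : ι), (∀ (f g h : SchwartzMap E4 ℝ), HasCompactSupport (f : E4 → ℝ) → HasCompactSupport (g : E4 → ℝ) → HasCompactSupport (h : E4 → ℝ) → Disjoint (tsupport f) (tsupport g) → Disjoint (tsupport f) (tsupport h) → Disjoint (tsupport g) (tsupport h) → ∀ (Ffgh : SchwartzMap (Fin 3 → E4) ℂ) (Fgh Ffh Ffg : SchwartzMap (Fin 2 → E4) ℂ) (Ff Fg Fh : SchwartzMap (Fin 1 → E4) ℂ), IsTensorOf Ffgh (fun i => ofRealTest (![f, g, h] i)) →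 IsOffDiagonal Ffgh → IsTensorOf Fgh (fun i => ofRealTest (![g, h] i)) → IsOffDiagonal Fgh → IsTensorOf Ffh (fun i => ofRealTest (![f, h] i)) → IsOffDiagonal Ffh → IsTensorOf Ffg (fun i => ofRealTest (![f, g] i)) → IsOffDiagonal Ffg → IsTensorOf Ff (fun i => ofRealTest (![f] i)) → IsOffDiagonal Ff → IsTensorOf Fg (fun i => ofRealTest (![g] i)) → IsOffDiagonal Fg → IsTensorOf Fh (fun i => ofRealTest (![h] i)) → IsOffDiagonal Fh → T.schwinger 3 (fun _ => s) Ffgh - T.schwinger 1 (fun _ => s) Ff * T.schwinger 2 (fun _ => s) Fgh - T.schwinger 1 (fun _ => s) Fg * T.schwinger 2 (fun _ => s) Ffh - T.schwinger 1 (fun _ => s) Fh * T.schwinger 2 (fun _ => s) Ffg + 2 * (T.schwinger 1 (fun _ => s) Ff * T.schwinger 1 (fun _ => s) Fg * T.schwinger 1 (fun _ => s) Fh) = 0) → ¬ T.IsNonGaussian s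

-- `OffDiagonalReduction` holds: proved by `Summit.QuantumFields.YangMills.Theorems.OffDiagonalReduction.boundedSkewnessRunning_offDiagonalReduction_proof` (its module imports this route file, so no `_holds` link can be stated here).

/-- item stmt-QuantumFields-19901 · assembly · rank 1 · closed · proved by Summit.QuantumFields.YangMills.Theorems.BoundedSkewnessRunning.assembly_proof (prover) · by planner
sources: Seiler2003, JaffeWitten2000
[assembly] UVSkewnessExtinction → SkewnessNonGeneration → SchemeCumulantScaling →
WindowFromNontriviality → OffDiagonalReduction → ¬ YangMills (the refutation, at G = SU(2), through
the IsNonGaussian clause). -/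
@[route_item "route-QuantumFields-BoundedSkewnessRunning"]
def Assembly : Prop :=
  UVSkewnessExtinction → SkewnessNonGeneration → SchemeCumulantScaling → WindowFromNontriviality → OffDiagonalReduction → ¬ YangMills

-- `Assembly` holds: proved by `Summit.QuantumFields.YangMills.Theorems.BoundedSkewnessRunning.assembly_proof` (its module imports this route file, so no `_holds` link can be stated here).

/-! D-0027 §2.1 — DECIDING THEOREM (planner-authored via `route open/edit --closes-file`; by planner-type-12b83f0fa1-0 2026-08-17T18:59:58Z):
its hypotheses are this route's items and its conclusion the sub-problem Statement (glue_lint), and it elaborates with this file. -/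

@[closes "route-QuantumFields-BoundedSkewnessRunning"] theorem closes (h₁ : UVSkewnessExtinction) (h₂ : SkewnessNonGeneration)
    (h₃ : SchemeCumulantScaling) (h₄ : WindowFromNontriviality) (h₅ : OffDiagonalReduction) :
    ¬ YangMills := by
  -- D-0027 deciding theorem (refutation form).  K1 (UV extinction of the self-normalised skewness
  -- of `tr F²` inside a polynomial UV window) on the UV companion scheme, K2 (non-generation under
  -- gap + RP window) back on the gapped scheme of a putative SU(2) witness, then the supports:
  -- c³-scaling (S1), window-from-nontriviality (S2), off-diagonal reduction of IsNonGaussian (S3).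
  intro hYM
  -- `SU(2)` is a compact simple Lie group (support S0 + the tree's fundamental representation)
  have hG : Literature.MathematicalPhysics.QuantumFieldTheory.IsCompactSimpleLieGroup (Matrix.specialUnitaryGroup (Fin 2) ℂ) :=
    Literature.MathematicalPhysics.QuantumFieldTheory.isCompactSimpleLieGroup_specialUnitaryGroup
      Literature.MathematicalPhysics.QuantumLattice.isSimpleCompactGroup_specialUnitaryGroup_holds le_rfl
  obtain ⟨r, sch, T, hw, hYMf, hNT, hNG, Δ, hΔ, -, hgap⟩ :=
    hYM (Matrix.specialUnitaryGroup (Fin 2) ℂ) hG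
  -- support S2: a compactly supported past-supported `u` with `c_k² T_k(u) → σ > 0` and the window
  obtain ⟨u, M, σ, huc, hun, hσ, hlim, hwin⟩ := h₄ _ r sch T hYMf hNT
  -- crux K1: the exponent `κ` and UV extinction
  obtain ⟨κ, hκ, hK1⟩ := h₁
  -- the UV companion scheme `a'_k = max (a_k, β_k^{-κ})`, same `β`, `L`
  have hβ : Filter.Tendsto sch.β Filter.atTop Filter.atTop := hw
  have hβκ : Filter.Tendsto (fun k => (sch.β k) ^ κ) Filter.atTop Filter.atTop :=
    (Filter.tendsto_pow_atTop (by omega)).comp hβ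
  let sch' : Literature.MathematicalPhysics.QuantumFieldTheory.SpeciesScheme
      (Literature.MathematicalPhysics.QuantumFieldTheory.YMSpecies (Matrix.specialUnitaryGroup (Fin 2) ℂ)) :=
    { sch with
      a := fun k => max (sch.a k) ((sch.β k) ^ κ)⁻¹
      a_pos := fun k => lt_max_of_lt_left (sch.a_pos k)
      tendsto_a := by
        have h := sch.tendsto_a.max (tendsto_inv_atTop_zero.comp hβκ)
        rw [max_self] at h
        refine h.congr (fun k => ?_)
        simp only [Function.comp_apply]
      tendsto_L := by
        refine Filter.tendsto_atTop_mono (fun k => ?_) sch.tendsto_L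
        exact mul_le_mul_of_nonneg_right (le_max_left _ _) (Nat.cast_nonneg _) }
  have hUV' : ∀ᶠ k in Filter.atTop, (sch'.a k)⁻¹ ≤ (sch'.β k) ^ κ := by
    filter_upwards [hβ.eventually_gt_atTop 0] with k hk
    have hp : 0 < ((sch.β k) ^ κ)⁻¹ := inv_pos.2 (pow_pos hk κ)
    have h1 : ((sch.β k) ^ κ)⁻¹ ≤ max (sch.a k) ((sch.β k) ^ κ)⁻¹ := le_max_right _ _
    have h2 := inv_anti₀ hp h1
    rwa [inv_inv] at h2
  have hw' : sch'.HasWeakCouplingLimit := hw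
  -- K1 on the companion, K2 back to the gapped scheme: extinction at `(sch, u)`
  have hext' : ∀ (u' f g h : SchwartzMap Summit.QuantumFields.YangMills.Theorems.SelfNormalisedSkewness.Negative.E4 ℝ), HasCompactSupport (u' : Summit.QuantumFields.YangMills.Theorems.SelfNormalisedSkewness.Negative.E4 → ℝ) →
      tsupport u' ⊆ {y : Summit.QuantumFields.YangMills.Theorems.SelfNormalisedSkewness.Negative.E4 | y 0 < 0} → HasCompactSupport (f : Summit.QuantumFields.YangMills.Theorems.SelfNormalisedSkewness.Negative.E4 → ℝ) →
      HasCompactSupport (g : Summit.QuantumFields.YangMills.Theorems.SelfNormalisedSkewness.Negative.E4 → ℝ) → HasCompactSupport (h : Summit.QuantumFields.YangMills.Theorems.SelfNormalisedSkewness.Negative.E4 → ℝ) →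
      Disjoint (tsupport f) (tsupport g) → Disjoint (tsupport f) (tsupport h) →
      Disjoint (tsupport g) (tsupport h) →
      Filter.Tendsto (Summit.QuantumFields.YangMills.Theorems.SelfNormalisedSkewness.Negative.cruxKappa3 r sch' u' f g h) Filter.atTop (nhds 0) :=
    fun u' f g h hu'c hu'n hf hg hh hfg hfh hgh =>
      hK1 r sch' u' hw' hUV' hu'c hu'n f g h hf hg hh hfg hfh hgh
  have hext := h₂ κ hκ r sch sch' u M Δ hw hΔ hgap huc hun hwin rfl rfl (fun k => le_max_left _ _)
    hUV' hext'
  -- eventually `T_k(u) > 0` (from `c_k² T_k(u) → σ > 0`)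
  have hTpos : ∀ᶠ k in Filter.atTop, 0 < Summit.QuantumFields.YangMills.Theorems.SelfNormalisedSkewness.Negative.cruxT r sch u k := by
    filter_upwards [hlim.eventually (lt_mem_nhds (half_lt_self hσ))] with k hk
    by_contra hle
    have : (sch.c r.curvature k) ^ 2 * Summit.QuantumFields.YangMills.Theorems.SelfNormalisedSkewness.Negative.cruxT r sch u k ≤ 0 :=
      mul_nonpos_of_nonneg_of_nonpos (sq_nonneg _) (not_lt.1 hle)
    linarith
  -- support S3 reduces `¬ IsNonGaussian` to the vanishing of the continuum cumulant on separated
  -- compactly supported real triples, which we now prove from the lattice side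
  refine h₅ _ T r.curvature ?_ hNG
  intro f g h hf hg hh hfg hfh hgh Ffgh Fgh Ffh Ffg Ff Fg Fh t3 o3 tgh ogh tfh ofh tfg ofg tf of1 tg og th oh
  -- the seven lattice → continuum limits (IsYangMillsFor on off-diagonal real tensors)
  have c3 := hYMf 3 (by norm_num) (fun _ => r.curvature) ![f, g, h] Ffgh t3 o3
  have c2gh := hYMf 2 (by norm_num) (fun _ => r.curvature) ![g, h] Fgh tgh ogh
  have c2fh := hYMf 2 (by norm_num) (fun _ => r.curvature) ![f, h] Ffh tfh ofh
  have c2fg := hYMf 2 (by norm_num) (fun _ => r.curvature) ![f, g] Ffg tfg ofg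
  have c1f := hYMf 1 (by norm_num) (fun _ => r.curvature) ![f] Ff tf of1
  have c1g := hYMf 1 (by norm_num) (fun _ => r.curvature) ![g] Fg tg og
  have c1h := hYMf 1 (by norm_num) (fun _ => r.curvature) ![h] Fh th oh
  have hC := (((c3.sub (c1f.mul c2gh)).sub (c1g.mul c2fh)).sub (c1h.mul c2fg)).add
    (((c1f.mul c1g).mul c1h).const_mul 2)
  -- the real cumulant along `sch` tends to `0`: `(c√T)³ κ₃^canon`, with `|c√T| = √(c²T) → √σ`
  have hκ0 := hext f g h hf hg hh hfg hfh hgh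
  have hψ' : Filter.Tendsto (fun k => (sch.c r.curvature k * Real.sqrt (Summit.QuantumFields.YangMills.Theorems.SelfNormalisedSkewness.Negative.cruxT r sch u k)) ^ 3 *
      Summit.QuantumFields.YangMills.Theorems.SelfNormalisedSkewness.Negative.cruxKappa3 r sch u f g h k) Filter.atTop (nhds 0) := by
    rw [tendsto_zero_iff_abs_tendsto_zero]
    have e : ∀ k, |(sch.c r.curvature k * Real.sqrt (Summit.QuantumFields.YangMills.Theorems.SelfNormalisedSkewness.Negative.cruxT r sch u k)) ^ 3 *
          Summit.QuantumFields.YangMills.Theorems.SelfNormalisedSkewness.Negative.cruxKappa3 r sch u f g h k| =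
        Real.sqrt ((sch.c r.curvature k) ^ 2 * Summit.QuantumFields.YangMills.Theorems.SelfNormalisedSkewness.Negative.cruxT r sch u k) ^ 3 *
          |Summit.QuantumFields.YangMills.Theorems.SelfNormalisedSkewness.Negative.cruxKappa3 r sch u f g h k| := by
      intro k
      rw [abs_mul, abs_pow, Real.sqrt_mul (sq_nonneg _), Real.sqrt_sq_eq_abs, abs_mul,
        abs_of_nonneg (Real.sqrt_nonneg _)]
    have h := ((hlim.sqrt).pow 3).mul hκ0.abs
    simp only [abs_zero, mul_zero] at h
    exact h.congr (fun k => (e k).symm)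
  have hψ : Filter.Tendsto (fun k =>
      Literature.MathematicalPhysics.QuantumFieldTheory.latticeSchwinger r.ρ sch (fun s => s.F) k 3 (fun _ => r.curvature) ![f, g, h] -
        Literature.MathematicalPhysics.QuantumFieldTheory.latticeSchwinger r.ρ sch (fun s => s.F) k 1 (fun _ => r.curvature) ![f] *
          Literature.MathematicalPhysics.QuantumFieldTheory.latticeSchwinger r.ρ sch (fun s => s.F) k 2 (fun _ => r.curvature) ![g, h] -
        Literature.MathematicalPhysics.QuantumFieldTheory.latticeSchwinger r.ρ sch (fun s => s.F) k 1 (fun _ => r.curvature) ![g] *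
          Literature.MathematicalPhysics.QuantumFieldTheory.latticeSchwinger r.ρ sch (fun s => s.F) k 2 (fun _ => r.curvature) ![f, h] -
        Literature.MathematicalPhysics.QuantumFieldTheory.latticeSchwinger r.ρ sch (fun s => s.F) k 1 (fun _ => r.curvature) ![h] *
          Literature.MathematicalPhysics.QuantumFieldTheory.latticeSchwinger r.ρ sch (fun s => s.F) k 2 (fun _ => r.curvature) ![f, g] +
        2 * (Literature.MathematicalPhysics.QuantumFieldTheory.latticeSchwinger r.ρ sch (fun s => s.F) k 1 (fun _ => r.curvature) ![f] *
          Literature.MathematicalPhysics.QuantumFieldTheory.latticeSchwinger r.ρ sch (fun s => s.F) k 1 (fun _ => r.curvature) ![g] *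
            Literature.MathematicalPhysics.QuantumFieldTheory.latticeSchwinger r.ρ sch (fun s => s.F) k 1 (fun _ => r.curvature) ![h]))
      Filter.atTop (nhds 0) :=
    hψ'.congr' (hTpos.mono fun k hk => (h₃ _ r sch u f g h k hk).symm)
  have hψC := (Complex.continuous_ofReal.tendsto 0).comp hψ
  have hΦ0 := hψC.congr (fun k => by
    simp only [Function.comp_apply]
    push_cast
    rfl)
  have huniq := tendsto_nhds_unique hC hΦ0
  simpa using huniq

end Summit.QuantumFields.YangMills.Theses.BoundedSkewnessRunning
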